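import Summits.RiemannHypothesis.RiemannHypothesis.Theorems.GroundBartaPolarPerronFrobeniusEvenSectorEulerLagrange
import HarnessLib

/-!
# Barta/Temple pinning of even-sector bottom states (route `RiemannHypothesis/GroundBarta`, rung 3
`PolarPerronFrobenius`, stmt-RiemannHypothesis-18390 — even-sector toolkit)

`evenSector_pinning`: if `u` is an even-sector bottom state at the window `a` (data: `u ∈ L²`, an
`L²`-normalised sequence of EVEN window tests `gₙ → u` in `L²` with `Re Q(gₙ) → ε_ev(a)`), `h` an
even window test and `T ∈ L²` represents the polarised Weil functional `g ↦ W(g ⋆ h̃)` on even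
window tests (`W(g ⋆ h̃) = ∫ g T̄`), then

  `|ε_ev(a)| · ‖∫ u h̄‖ ≤ ‖T‖₂`.

Proof: the even-sector weak Euler–Lagrange equation `W(gₙ ⋆ h̃) → ε_ev(a)⟨u, h⟩`
(`evenSector_eulerLagrange`) and Cauchy–Schwarz `|W(gₙ ⋆ h̃)| = |⟨gₙ, T⟩| ≤ ‖gₙ‖₂‖T‖₂ = ‖T‖₂`.
The last theorem `evenPinning_routeForm` is, token for token, item `EvenPinning`
(stmt-RiemannHypothesis-19849, "provable now") of the draft route `EvenThetaVisibilityPinning`.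
RH-free. References: Bombieri 2000 §4 Lemma 1; Temple/Barta pinning (folklore).
-/

set_option linter.dupNamespace false

noncomputable section

open Set MeasureTheory Filter Complex
open scoped Real Topology ComplexConjugate

namespace Summit.RiemannHypothesis.RiemannHypothesis.Theorems.PolarPerronFrobenius

open Literature.NumberTheory.LFunctions

/-- **Cauchy–Schwarz for a represented functional on a normalised test**: if
`W(g ⋆ h̃) = ∫ g T̄` with `T ∈ L²` and `∫|g|² = 1`, then `‖W(g ⋆ h̃)‖ ≤ √∫|T|²`. [folklore] -/
theorem evenSector_norm_rep_le {g h T : ℝ → ℂ} (hg : IsWeilTest g) (hn : ∫ t, ‖g t‖ ^ 2 = (1 : ℝ))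
    (hT : MemLp T 2)
    (hrep : weilFunctional (weilConv g (weilReflect h)) = ∫ t, g t * conj (T t)) :
    ‖weilFunctional (weilConv g (weilReflect h))‖ ≤ Real.sqrt (∫ t, ‖T t‖ ^ 2) := by
  rw [hrep]
  have h1 := ConnesVanSuijlekom.norm_integral_mul_conj_sub_le
    (ConnesVanSuijlekom.isWeilTest_memLp hg) hT (MemLp.zero' (p := 2) (μ := volume))
  simp only [map_zero, mul_zero, integral_zero, sub_zero] at h1
  rw [hn, Real.sqrt_one, one_mul] at h1
  exact h1

/-- **Pinning of an even-sector bottom state against a represented even test.**  For the data of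
an even-sector bottom state `u` at `a` (`gₙ` even normalised window tests, `Re Q(gₙ) → ε_ev(a)`,
`gₙ → u` in `L²`), an even window test `h`, and `T ∈ L²` with `W(g ⋆ h̃) = ∫ g T̄` for all even
window tests `g`: `|ε_ev(a)| · ‖∫ u h̄‖ ≤ √∫|T|²`. [cite: Bombieri2000Weil, §4 Lemma 1] -/
theorem evenSector_pinning {a : ℝ} {u h T : ℝ → ℂ} {g : ℕ → ℝ → ℂ}
    (hg : ∀ n, IsWeilTest (g n) ∧ tsupport (g n) ⊆ Icc (-a) a ∧ (∀ t, g n (-t) = g n t) ∧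
      ∫ t, ‖g n t‖ ^ 2 = (1 : ℝ))
    (hQ : Tendsto (fun n => (weilQuadratic (g n)).re) atTop (𝓝 (weilEvenGroundEnergy a)))
    (hu : MemLp u 2) (hL : Tendsto (fun n => ∫ t, ‖g n t - u t‖ ^ 2) atTop (𝓝 0))
    (hh : IsWeilTest h) (hhs : tsupport h ⊆ Icc (-a) a) (hhe : ∀ t, h (-t) = h t)
    (hT : MemLp T 2)
    (hrep : ∀ g : ℝ → ℂ, IsWeilTest g → tsupport g ⊆ Icc (-a) a → (∀ t, g (-t) = g t) →
      weilFunctional (weilConv g (weilReflect h)) = ∫ t, g t * conj (T t)) :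
    |weilEvenGroundEnergy a| * ‖∫ t, u t * conj (h t)‖ ≤ Real.sqrt (∫ t, ‖T t‖ ^ 2) :=
  evenSector_abs_energy_mul_norm_inner_le hg hQ hu hL hh hhs hhe
    (Eventually.of_forall fun n =>
      evenSector_norm_rep_le (hg n).1 (hg n).2.2.2 hT (hrep (g n) (hg n).1 (hg n).2.1 (hg n).2.2.1))

/-- **The same for `IsWeilEvenGroundState`** (the junk-free / `Tendsto` encodings agree,
`isWeilEvenGroundState_iff_tendsto`). [folklore] -/
theorem IsWeilEvenGroundState.pinning {a : ℝ} {u h T : ℝ → ℂ} (hu : IsWeilEvenGroundState a u)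
    (hh : IsWeilTest h) (hhs : tsupport h ⊆ Icc (-a) a) (hhe : ∀ t, h (-t) = h t)
    (hT : MemLp T 2)
    (hrep : ∀ g : ℝ → ℂ, IsWeilTest g → tsupport g ⊆ Icc (-a) a → (∀ t, g (-t) = g t) →
      weilFunctional (weilConv g (weilReflect h)) = ∫ t, g t * conj (T t)) :
    |weilEvenGroundEnergy a| * ‖∫ t, u t * conj (h t)‖ ≤ Real.sqrt (∫ t, ‖T t‖ ^ 2) := by
  obtain ⟨g, hg, hQ, hL⟩ := hu.exists_tendsto
  exact evenSector_pinning hg hQ hu.memLp hL hh hhs hhe hT hrep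

/-- **Route form of item `EvenPinning` (draft route `EvenThetaVisibilityPinning`,
stmt-RiemannHypothesis-19849), token for token.** [cite: Bombieri2000Weil, §4 Lemma 1] -/
theorem evenPinning_routeForm :
    (∀ a : ℝ, ∀ u h T : ℝ → ℂ, (MeasureTheory.MemLp u 2 ∧ ∃ g : ℕ → ℝ → ℂ, (∀ n, Literature.NumberTheory.LFunctions.IsWeilTest (g n) ∧ tsupport (g n) ⊆ Set.Icc (-a) a ∧ (∀ t, g n (-t) = g n t) ∧ ∫ t, ‖g n t‖ ^ 2 = (1 : ℝ)) ∧ Filter.Tendsto (fun n => (Literature.NumberTheory.LFunctions.weilQuadratic (g n)).re) Filter.atTop (nhds (Literature.NumberTheory.LFunctions.weilEvenGroundEnergy a)) ∧ Filter.Tendsto (fun n => ∫ t, ‖g n t - u t‖ ^ 2) Filter.atTop (nhds 0)) → Literature.NumberTheory.LFunctions.IsWeilTest h → tsupport h ⊆ Set.Icc (-a) a → (∀ t, h (-t) = h t) → MeasureTheory.MemLp T 2 → (∀ g : ℝ → ℂ, Literature.NumberTheory.LFunctions.IsWeilTest g → tsupport g ⊆ Set.Icc (-a) a → (∀ t, g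 (-t) = g t) → Literature.NumberTheory.LFunctions.weilFunctional (Literature.NumberTheory.LFunctions.weilConv g (Literature.NumberTheory.LFunctions.weilReflect h)) = ∫ t, g t * (starRingEnd ℂ) (T t)) → |Literature.NumberTheory.LFunctions.weilEvenGroundEnergy a| * ‖∫ t, u t * (starRingEnd ℂ) (h t)‖ ≤ Real.sqrt (∫ t, ‖T t‖ ^ 2)) := by
  intro a u h T hdata hh hhs hhe hT hrep
  obtain ⟨hu2, g, hg, hQ, hL⟩ := hdata
  exact evenSector_pinning hg hQ hu2 hL hh hhs hhe hT hrep

end Summit.RiemannHypothesis.RiemannHypothesis.Theorems.PolarPerronFrobenius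

end
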